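import Literature.GroupTheory.QuasirandomGroups.AlternatingProductMixing
import Literature.GroupTheory.QuasirandomGroups.ProductMixingProofs
import Literature.RepresentationTheory.FiniteGroups.AlternatingGroupMinimalDegree
import Mathlib.GroupTheory.SpecificGroups.Alternating
import HarnessLib

/-!
# Product mixing in `𝔄_n` from Gowers' theorem and the minimal degree of `𝔄_n`

Topic `Literature/GroupTheory/QuasirandomGroups`.  Theorems only (no definition, no named fact, no
instance, no notation): the BRIDGE

* **`alternatingProductMixing_of_minDegree : JamesKerber1981_thm_2_5_15 → alternatingProductMixing`**

reducing the typed fact `alternatingProductMixing` (`AlternatingProductMixing.lean`; the consumer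
statement `AlternatingMixing` of the `ValiantsHypothesis` line «mixing-scale» on stmt-18293:
`X·Y·Z = 𝔄_n` once `(n−1)|X||Y||Z| > |𝔄_n|³`, `n > 8`) to the single classical fact that a
non-trivial irreducible representation of `𝔄_n` (`n ∉ {3,4,5}`) has dimension `≥ n − 1`
(James–Kerber 2.5.15, typed as `Literature.RepresentationTheory.FiniteGroups.JamesKerber1981_thm_2_5_15`),
through the PROVED product-mixing theorem of Gowers in its irreducible-hypothesis form
(`product_mixing_of_irreducible`, `ProductMixingProofs.lean`): inside `G = 𝔄_n` take `A = X`,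
`B = Y`, `C = ρZ⁻¹` read as `{c : c⁻¹ρ ∈ Z}` (so `ab = c` gives `a·b·(c⁻¹ρ) = ρ`), `k = n − 1`,
`|G| = n!/2` (Mathlib's `two_mul_card_alternatingGroup`).  This is exactly Nikolov–Pyber's
derivation of their Corollary 2 from Proposition 1 (held text `paper:arxiv-math_0703343`, p0003
L71–78: "for any `g ∈ G` the intersection of the sets `AB` and `gC⁻¹` is non-empty, which implies
`g ∈ ABC`").  Honest framing: a bridging lemma; `VP ≠ VNP` is NOT proved and nothing here is
progress on it.
-/

noncomputable section

namespace Literature.GroupTheory.QuasirandomGroups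

open Equiv Literature.RepresentationTheory.FiniteGroups

/-- **`𝔄_n` product mixing from the minimal degree of `𝔄_n`** (Nikolov–Pyber 2011, Cor. 2 for
`G = 𝔄_n`, `k = n − 1`, over Gowers 2008 Thm. 3.3 — here the tree's PROVED
`product_mixing_of_irreducible` — and James–Kerber 2.5.15): the typed consumer fact
`alternatingProductMixing` holds as soon as every non-trivial irreducible complex representation
of `𝔄_n`, `n ∉ {3,4,5}`, has dimension `≥ n − 1`. [cite: NikolovPyber2011, Cor. 2 (proof)] -/
theorem alternatingProductMixing_of_minDegree (hmin : JamesKerber1981_thm_2_5_15) :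
    alternatingProductMixing := by
  intro n hn X Y Z hX hY hZ hcard ρ hρ
  classical
  haveI : Nontrivial (Fin n) := Fin.nontrivial_iff_two_le.mpr (by omega)
  -- the group `G = 𝔄_n` and its order
  have hcardG : Fintype.card ↥(alternatingGroup (Fin n)) = Nat.factorial n / 2 := by
    have h2 := two_mul_card_alternatingGroup (α := Fin n)
    rw [Fintype.card_perm, Fintype.card_fin] at h2
    omega
  -- `𝔄_n` is `(n-1)`-quasirandom (irreducible form), from James–Kerber 2.5.15
  have hq : ∀ (V : Type) [AddCommGroup V] [Module ℂ V] [FiniteDimensional ℂ V]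
      (τ : Representation ℂ ↥(alternatingGroup (Fin n)) V), τ.IsIrreducible →
      Module.finrank ℂ V < n - 1 → ∀ g : ↥(alternatingGroup (Fin n)), τ g = LinearMap.id := by
    intro V _ _ _ τ hτ hlt g
    by_contra hg
    have := hmin n (by omega) (by omega) (by omega) V τ hτ ⟨g, hg⟩
    omega
  -- the three subsets of `𝔄_n`
  set ρ' : ↥(alternatingGroup (Fin n)) := ⟨ρ, Equiv.Perm.mem_alternatingGroup.mpr hρ⟩ with hρ'
  set A : Finset ↥(alternatingGroup (Fin n)) :=
    Finset.univ.filter fun g => (g : Perm (Fin n)) ∈ X with hA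
  set B : Finset ↥(alternatingGroup (Fin n)) :=
    Finset.univ.filter fun g => (g : Perm (Fin n)) ∈ Y with hB
  set C : Finset ↥(alternatingGroup (Fin n)) :=
    Finset.univ.filter fun g => ((g⁻¹ * ρ' : ↥(alternatingGroup (Fin n))) : Perm (Fin n)) ∈ Z
    with hC
  have hAc : A.card = X.card := by
    refine Finset.card_bij (fun g _ => (g : Perm (Fin n))) ?_ ?_ ?_
    · intro g hg; exact (Finset.mem_filter.1 hg).2
    · intro g _ g' _ h; exact Subtype.ext h
    · intro x hx
      exact ⟨⟨x, Equiv.Perm.mem_alternatingGroup.mpr (hX x hx)⟩,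
        Finset.mem_filter.2 ⟨Finset.mem_univ _, hx⟩, rfl⟩
  have hBc : B.card = Y.card := by
    refine Finset.card_bij (fun g _ => (g : Perm (Fin n))) ?_ ?_ ?_
    · intro g hg; exact (Finset.mem_filter.1 hg).2
    · intro g _ g' _ h; exact Subtype.ext h
    · intro y hy
      exact ⟨⟨y, Equiv.Perm.mem_alternatingGroup.mpr (hY y hy)⟩,
        Finset.mem_filter.2 ⟨Finset.mem_univ _, hy⟩, rfl⟩
  have hCc : C.card = Z.card := by
    refine Finset.card_bij
      (fun g _ => ((g⁻¹ * ρ' : ↥(alternatingGroup (Fin n))) : Perm (Fin n))) ?_ ?_ ?_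
    · intro g hg; exact (Finset.mem_filter.1 hg).2
    · intro g _ g' _ h
      have h' : g⁻¹ * ρ' = g'⁻¹ * ρ' := Subtype.ext h
      exact inv_injective (mul_right_cancel h')
    · intro z hz
      set z' : ↥(alternatingGroup (Fin n)) := ⟨z, Equiv.Perm.mem_alternatingGroup.mpr (hZ z hz)⟩
        with hz'
      have hval : (((ρ' * z'⁻¹)⁻¹ * ρ' : ↥(alternatingGroup (Fin n))) : Perm (Fin n)) = z := by
        rw [mul_inv_rev, inv_inv, mul_assoc, inv_mul_cancel, mul_one]
      refine ⟨ρ' * z'⁻¹, Finset.mem_filter.2 ⟨Finset.mem_univ _, ?_⟩, hval⟩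
      rw [hval]; exact hz
  -- Gowers' theorem (irreducible form) in `𝔄_n` with `k = n - 1`
  have hk : 1 ≤ n - 1 := by omega
  obtain ⟨hex, -⟩ := product_mixing_of_irreducible ↥(alternatingGroup (Fin n)) (n - 1) hk hq A B C
  have hkpos : (0 : ℝ) < ((n - 1 : ℕ) : ℝ) := by exact_mod_cast hk
  have hlt : (Fintype.card ↥(alternatingGroup (Fin n)) : ℝ) ^ 3 / ((n - 1 : ℕ) : ℝ) <
      (A.card : ℝ) * B.card * C.card := by
    rw [hAc, hBc, hCc, hcardG, div_lt_iff₀ hkpos]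
    calc ((Nat.factorial n / 2 : ℕ) : ℝ) ^ 3 = (((Nat.factorial n / 2) ^ 3 : ℕ) : ℝ) := by
          push_cast; ring
      _ < (((n - 1) * (X.card * Y.card * Z.card) : ℕ) : ℝ) := by exact_mod_cast hcard
      _ = (X.card : ℝ) * Y.card * Z.card * ((n - 1 : ℕ) : ℝ) := by push_cast; ring
  obtain ⟨a, ha, b, hb, c, hc, habc⟩ := hex hlt
  refine ⟨a, (Finset.mem_filter.1 ha).2, b, (Finset.mem_filter.1 hb).2,
    ((c⁻¹ * ρ' : ↥(alternatingGroup (Fin n))) : Perm (Fin n)), (Finset.mem_filter.1 hc).2, ?_⟩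
  rw [← habc, ← Subgroup.coe_mul, ← Subgroup.coe_mul, mul_inv_cancel_left]

end Literature.GroupTheory.QuasirandomGroups

end
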